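import Literature.AlgebraicGeometry.Motives.MixedHodgeStructureIndecomposable
import Mathlib.Algebra.DirectSum.Module
import HarnessLib

/-!
# Every mixed Hodge structure is a finite direct sum of indecomposable sub-MHS

Objects of finite length of an abelian category — here mixed Hodge structures on finite-dimensional `ℚ`-spaces
(Cattani–El Zein–Griffiths–Lê, *Hodge Theory*, Thm. 3.2.18; semisimple objects p. 270) — decompose into finitely
many indecomposable direct summands (the existence half of the Krull–Schmidt theorem). With the tree's
`exists_isCompl_isIndecomposable` (an indecomposable direct summand exists, `MixedHodgeStructureIndecomposable`) the
proof is an induction on the dimension: split off an indecomposable summand `S`, decompose its complement `T`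
inside `T`, and push the pieces back into `H`. Namespace `MixedHodgeStructure`; everything proved, no named facts:
**`exists_iSupIndep_isIndecomposable`** (an independent finite family of indecomposable sub-MHS with supremum `H`)
and its `DirectSum.IsInternal` form.

## References

* [CattaniElZeinGriffithsLe2014] E. Cattani et al. (eds.), Hodge Theory (2014), Thm. 3.2.18, Lemma 3.2.20, p. 270.
-/

noncomputable section

namespace Literature.AlgebraicGeometry.Motives

namespace MixedHodgeStructure

universe u

open Module

/-- The zero MHS is the empty direct sum. [cite: CattaniElZeinGriffithsLe2014, p. 270] -/
private theorem decomposition_of_subsingleton {W : Type u} [AddCommGroup W] [Module ℚ W] [Subsingleton W]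
    (G : MixedHodgeStructure W) :
    ∃ (n : ℕ) (S : Fin n → SubMixedHodgeStructure G), iSupIndep (fun i => (S i).toSubmodule) ∧
      (⨆ i, (S i).toSubmodule) = ⊤ ∧ ∀ i, (S i).toMixedHodgeStructure.IsIndecomposable := by
  haveI : Subsingleton (Submodule ℚ W) := (Submodule.subsingleton_iff ℚ).2 inferInstance
  exact ⟨0, fun i => i.elim0, iSupIndep_def.2 fun i => i.elim0, Subsingleton.elim _ _, fun i => i.elim0⟩

/-- For `H = S ⊕ T` and sub-spaces `X, Y ⊆ T` (given inside `T`) with `X ∩ Y = 0`: `X ∩ (S + Y) = 0`.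
[cite: CattaniElZeinGriffithsLe2014, Thm. 3.2.18] -/
private theorem disjoint_map_subtype_sup {W : Type u} [AddCommGroup W] [Module ℚ W] (S T : Submodule ℚ W)
    (hST : IsCompl S T) (X Y : Submodule ℚ T) (hXY : Disjoint X Y) :
    Disjoint (X.map T.subtype) (S ⊔ Y.map T.subtype) := by
  rw [disjoint_iff, eq_bot_iff]
  rintro x ⟨hx1, hx2⟩
  obtain ⟨a, ha, rfl⟩ := Submodule.mem_map.1 hx1
  obtain ⟨s, hs, y, hy, hsy⟩ := Submodule.mem_sup.1 hx2
  obtain ⟨b, hb, rfl⟩ := Submodule.mem_map.1 hy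
  have hsT : s ∈ T := by
    rw [show s = T.subtype a - T.subtype b by rw [← hsy]; abel]
    exact T.sub_mem a.2 b.2
  have hs0 : s = 0 := by
    have h := Submodule.mem_inf.2 ⟨hs, hsT⟩
    rwa [hST.inf_eq_bot, Submodule.mem_bot] at h
  rw [hs0, zero_add] at hsy
  have hab : b = a := Subtype.ext hsy
  have ha0 : a ∈ X ⊓ Y := Submodule.mem_inf.2 ⟨ha, hab ▸ hb⟩
  rw [hXY.eq_bot, Submodule.mem_bot] at ha0
  rw [Submodule.mem_bot, ha0, map_zero]

/-- The induction on the dimension. [cite: CattaniElZeinGriffithsLe2014, Thm. 3.2.18 and p. 270] -/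
private theorem decomposition_aux (d : ℕ) : ∀ {W : Type u} [AddCommGroup W] [Module ℚ W] [FiniteDimensional ℚ W]
    (G : MixedHodgeStructure W), finrank ℚ W ≤ d →
    ∃ (n : ℕ) (S : Fin n → SubMixedHodgeStructure G), iSupIndep (fun i => (S i).toSubmodule) ∧
      (⨆ i, (S i).toSubmodule) = ⊤ ∧ ∀ i, (S i).toMixedHodgeStructure.IsIndecomposable := by
  induction d with
  | zero =>
    intro W _ _ _ G hd
    haveI : Subsingleton W := finrank_zero_iff.1 (Nat.le_zero.1 hd)
    exact decomposition_of_subsingleton G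
  | succ d ih =>
    intro W _ _ _ G hd
    by_cases hW : Subsingleton W
    · exact decomposition_of_subsingleton G
    rw [not_subsingleton_iff_nontrivial] at hW
    obtain ⟨S, T, hST, hS⟩ := exists_isCompl_isIndecomposable G
    haveI := hS.nontrivial
    have hT : finrank ℚ T.toSubmodule ≤ d := by
      have h1 := Submodule.finrank_add_eq_of_isCompl hST
      have h2 : 0 < finrank ℚ S.toSubmodule := finrank_pos
      omega
    obtain ⟨n, S', hind, hsup, hS'⟩ := ih T.toMixedHodgeStructure hT
    refine ⟨n + 1, (Fin.cons S (fun i => T.ofSub (S' i)) : Fin (n + 1) → SubMixedHodgeStructure G), ?_, ?_, ?_⟩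
    · -- independence
      rw [iSupIndep_def]
      intro i
      refine Fin.cases ?_ (fun k => ?_) i
      · simp only [Fin.cons_zero]
        have hle : (⨆ (j : Fin (n + 1)) (_ : j ≠ 0),
            ((Fin.cons S (fun i => T.ofSub (S' i)) : Fin (n + 1) → SubMixedHodgeStructure G) j).toSubmodule) ≤
            T.toSubmodule := by
          refine iSup_le fun j => iSup_le fun hj => ?_
          obtain ⟨j', rfl⟩ := Fin.exists_succ_eq.2 hj
          simp only [Fin.cons_succ]
          exact T.ofSub_toSubmodule_le _
        exact hST.disjoint.mono_right hle
      · simp only [Fin.cons_succ]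
        have hle : (⨆ (j : Fin (n + 1)) (_ : j ≠ k.succ),
            ((Fin.cons S (fun i => T.ofSub (S' i)) : Fin (n + 1) → SubMixedHodgeStructure G) j).toSubmodule) ≤
            S.toSubmodule ⊔ (⨆ (j : Fin n) (_ : j ≠ k), (S' j).toSubmodule).map T.toSubmodule.subtype := by
          refine iSup_le fun j => ?_
          refine Fin.cases ?_ (fun j' => ?_) j
          · exact iSup_le fun _ => by simp only [Fin.cons_zero]; exact le_sup_left
          · refine iSup_le fun hj => ?_
            have hjk : j' ≠ k := fun h => hj (by rw [h])
            simp only [Fin.cons_succ, SubMixedHodgeStructure.ofSub_toSubmodule]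
            exact le_sup_of_le_right (Submodule.map_mono
              (le_iSup₂ (f := fun (j : Fin n) (_ : j ≠ k) => (S' j).toSubmodule) j' hjk))
        refine Disjoint.mono_right hle ?_
        rw [SubMixedHodgeStructure.ofSub_toSubmodule]
        exact disjoint_map_subtype_sup S.toSubmodule T.toSubmodule hST _ _ (hind k)
    · -- supremum
      refine eq_top_iff.2 ?_
      rw [← hST.sup_eq_top]
      refine sup_le (le_iSup_of_le 0 (by simp only [Fin.cons_zero]; exact le_rfl)) fun x hx => ?_
      have hx' : (⟨x, hx⟩ : ↥T.toSubmodule) ∈ ⨆ i, (S' i).toSubmodule := by rw [hsup]; exact Submodule.mem_top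
      have hx'' := Submodule.mem_map_of_mem (f := T.toSubmodule.subtype) hx'
      rw [Submodule.map_iSup] at hx''
      have hle : (⨆ i, (S' i).toSubmodule.map T.toSubmodule.subtype) ≤
          ⨆ i, ((Fin.cons S (fun i => T.ofSub (S' i)) : Fin (n + 1) → SubMixedHodgeStructure G) i).toSubmodule :=
        iSup_le fun i => le_iSup_of_le i.succ (by
          simp only [Fin.cons_succ, SubMixedHodgeStructure.ofSub_toSubmodule]; exact le_rfl)
      exact hle hx''
    · -- indecomposability
      intro i
      refine Fin.cases ?_ (fun j => ?_) i
      · exact hS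
      · change (T.ofSub (S' j)).toMixedHodgeStructure.IsIndecomposable
        obtain ⟨e, he⟩ := T.exists_hom_ofSub_bijective (S' j)
        exact (hS' j).of_bijective e he

variable {V : Type u} [AddCommGroup V] [Module ℚ V] [FiniteDimensional ℚ V]

/-- **Every MHS is a finite direct sum of indecomposable sub-MHS**: there is a finite independent family of
indecomposable sub-MHS whose sum is `H` (existence part of Krull–Schmidt).
[cite: CattaniElZeinGriffithsLe2014, Thm. 3.2.18 and p. 270] -/
theorem exists_iSupIndep_isIndecomposable (H : MixedHodgeStructure V) :
    ∃ (n : ℕ) (S : Fin n → SubMixedHodgeStructure H), iSupIndep (fun i => (S i).toSubmodule) ∧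
      (⨆ i, (S i).toSubmodule) = ⊤ ∧ ∀ i, (S i).toMixedHodgeStructure.IsIndecomposable :=
  decomposition_aux (finrank ℚ V) H le_rfl

/-- The same as an internal direct sum `V = ⊕ᵢ Sᵢ`. [cite: CattaniElZeinGriffithsLe2014, Thm. 3.2.18 and p. 270] -/
theorem exists_isInternal_isIndecomposable (H : MixedHodgeStructure V) :
    ∃ (n : ℕ) (S : Fin n → SubMixedHodgeStructure H), DirectSum.IsInternal (fun i => (S i).toSubmodule) ∧
      ∀ i, (S i).toMixedHodgeStructure.IsIndecomposable := by
  obtain ⟨n, S, hind, hsup, hS⟩ := exists_iSupIndep_isIndecomposable H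
  exact ⟨n, S, (DirectSum.isInternal_submodule_iff_iSupIndep_and_iSup_eq_top _).2 ⟨hind, hsup⟩, hS⟩

omit [FiniteDimensional ℚ V] in
/-- A semisimple MHS: the indecomposable summands of any such decomposition are simple.
[cite: CattaniElZeinGriffithsLe2014, p. 270] -/
theorem IsSemisimple.isSimple_of_isIndecomposable_summand {H : MixedHodgeStructure V} (h : H.IsSemisimple)
    (S : SubMixedHodgeStructure H) (hS : S.toMixedHodgeStructure.IsIndecomposable) : S.toMixedHodgeStructure.IsSimple :=
  hS.isSimple_of_isSemisimple (h.subMixedHodgeStructure S)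

/-- Conversely, if `H` is NOT semisimple, some indecomposable summand in every such decomposition is not simple.
[cite: CattaniElZeinGriffithsLe2014, p. 270] -/
theorem exists_summand_not_isSimple {H : MixedHodgeStructure V} (h : ¬H.IsSemisimple) {n : ℕ}
    (S : Fin n → SubMixedHodgeStructure H) (hsup : (⨆ i, (S i).toSubmodule) = ⊤) :
    ∃ i, ¬(S i).toMixedHodgeStructure.IsSimple := by
  by_contra hall
  simp only [not_exists, not_not] at hall
  refine h (isSemisimple_of_biSup_finset_eq_top S Finset.univ (fun i _ => (hall i).isSemisimple) ?_)
  rw [← hsup]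
  exact iSup_congr fun i => iSup_pos (Finset.mem_univ i)

end MixedHodgeStructure

end Literature.AlgebraicGeometry.Motives
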